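import Summits.AtomisticToContinuum.HydrodynamicLimit.Theses.TwoClocks
import Summits.AtomisticToContinuum.HydrodynamicLimit.Theses.UGibbsSRBRigidity
import Summits.AtomisticToContinuum.HydrodynamicLimit.Theorems.ImplosionDichotomyHydroLimitInBandOfHeart
import Summits.AtomisticToContinuum.HydrodynamicLimit.Theorems.TwoClocksTransferEntropyClockFamilyNodesReduction
import Summits.AtomisticToContinuum.HydrodynamicLimit.Theorems.OneFlightGossipEngineKineticCurrentsLDAlongFamiliesKCWUSharpPlus
import Summits.AtomisticToContinuum.HydrodynamicLimit.Theorems.OneFlightGossipEngineClampedTransferDockWindowClauseRate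
import Summits.AtomisticToContinuum.HydrodynamicLimit.Theorems.OneFlightGossipEngineClampedTransferDockLedgerEndD
import Summits.AtomisticToContinuum.HydrodynamicLimit.Theorems.ImplosionDichotomyHydroLimitInBandWindowContinuity
import Summits.AtomisticToContinuum.HydrodynamicLimit.Theorems.ImplosionDichotomyHydroLimitInBandActivityTailsOfTransfer
import Summits.AtomisticToContinuum.HydrodynamicLimit.Theorems.OneFlightGossipEngineAssembly
import HarnessLib

/-!
# Line `tail-rate` of crux stmt-AtomisticToContinuum-16625 `TwoClocks.TransferEntropyClock`: the registered stub signatures and the conditional closing (support file)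

The three registered stub SIGNATURES of the skeleton `Cruxes/TransferEntropyClock/Lines/tail_rate.lean` (v2 = lead's v11, 2026-08-17T04:55Z) that are
not already tree declarations — `KCWUSharpPlus` (S_K; byte-identical with crux 16659's open stub), `KineticLDExplicitFamily` (S_E's target: the kinetic
family node with tilt radius `β₁` BEFORE the weights and bound for `|β| ≤ β₁/C`) and `TailRateWindowClause` (S_W′: the D-shape one-window ledger from the
tail-rate inputs; conclusion verbatim = `ClampedTransferDockRate.WindowClauseRate`'s) — declared ONCE here so that the stub workers' files and the
planner's split can import them, together with the line's CONDITIONAL CLOSING, sorry-free: `transferEntropyClock_of_tailRateNodes` (the crux by name from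
the five stubs as hypotheses: the explicit-family upgrade S_E, the D-ledger S_W′, the rung S_K, the local transfer node, the Gaussian tails item 14415)
and `transferEntropyClock_of_tailRateChildren_of` (the same packaged as: S_E → S_W′ → [the 3-child glue `KCWUSharpPlus → LocalClampedTransferWindowLDFamily →
GaussianTails → TransferEntropyClock`]). Composition = the skeleton's: landed D-ledger end `ClampedTransferDockLedgerEndD.stub_ledgerEndD` (p139514), window
continuity (p118327), a-priori bound, `relEntropyVanishingInBand_of_gronwallCoreInBand`, `hydroLimitInBand_of_relEntropyVanishingInBand`; C′ idle through
the local transfer child, TA/ECT consumed, KWLDU/DSC idle. Defs are route-internal stub signatures, not cited facts.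
Lead prover-line-stmt-AtomisticToContinuum-16625-c5-0, cycle 3.
-/

noncomputable section

namespace Summit.AtomisticToContinuum.HydrodynamicLimit.Theorems.TransferEntropyClockTailRate

open MeasureTheory Filter Set Topology InformationTheory
open scoped ENNReal
open Literature.MathematicalPhysics.KineticTheory Literature.Analysis.FluidPDE Literature.Analysis.FunctionSpaces
open Summit.AtomisticToContinuum.HydrodynamicLimit.Theses
open Summit.AtomisticToContinuum.HydrodynamicLimit.Theorems
open Summit.AtomisticToContinuum.HydrodynamicLimit.Theorems.HydroLimitInBandOfHeart
  (GronwallCoreInBand LocalClampedTransferWindowLDFamily CollisionEnergyActivityTails KineticCurrentsWindowLDFamily)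

/-! ## §1 The registered stub signatures (verbatim from `Lines/tail_rate.lean` v2) -/

/-- registered stub signature `stub_kcwuSharpPlus` of line tail-rate, crux TransferEntropyClock (stmt-AtomisticToContinuum-16625) — route-internal, not a cited fact.
**S_K target `KCWUSharpPlus`** — byte-identical with the registered open stub `stub_kcwuSharpPlus` of crux
stmt-AtomisticToContinuum-16659 (line `Sketch` v6): the POINTWISE kinetic-window LD rung with a NUMERIC tilt threshold
`β₀ = β₀(Θ,U,C,Λ,σ)` for the class `A(x):w⊗w + (b(x)·w)G(x,|w|²) + K(x,|w|²)`, `w = v − u₀(x)`, growth `C(1+‖v‖²)`,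
orthogonal to `1, v_j, ‖v‖²` under the local Maxwellian at every `x`. -/
def KCWUSharpPlus : Prop :=
  ∃ η₀ : ℝ, 0 < η₀ ∧ ∀ (Θ U C Λ : ℝ), 1 ≤ Θ → 0 ≤ U → 0 ≤ C → 1 ≤ Λ → ∀ σ : ℝ, 0 < σ →
      ∃ β₀ : ℝ, 0 < β₀ ∧
      ∀ (a θ₀ : T3 → ℝ) (u₀ : T3 → V3), Continuous a → Continuous θ₀ → Continuous u₀ →
      (∀ x, Λ⁻¹ ≤ a x ∧ a x ≤ Λ) → (∀ x, Θ⁻¹ ≤ θ₀ x ∧ θ₀ x ≤ Θ) → (∀ x, ‖u₀ x‖ ≤ U) →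
      σ ^ 3 * (⨆ x, a x) ≤ η₀ * ∫ x, a x →
      ∀ Φ : (N : ℕ) →
        HardSphereFlow (Torus.geometry (Fin 3)) (hsDiameter σ N) (N + 1),
      ∀ (A : T3 → Fin 3 → Fin 3 → ℝ) (b : T3 → V3) (G K : T3 × ℝ → ℝ),
      Continuous A → Continuous b → Continuous G → Continuous K →
      ∀ F : T3 × V3 → ℝ, (∀ y, F y =
        (∑ j : Fin 3, ∑ k : Fin 3, A y.1 j k * ((y.2 - u₀ y.1) j * (y.2 - u₀ y.1) k)) +
          (∑ j : Fin 3, b y.1 j * (y.2 - u₀ y.1) j) * G (y.1, ‖y.2 - u₀ y.1‖ ^ 2) +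
          K (y.1, ‖y.2 - u₀ y.1‖ ^ 2)) →
      (∀ y, |F y| ≤ C * (1 + ‖y.2‖ ^ 2)) →
      (∀ x, ∫ v, F (x, v) * localMaxwellian 1 (θ₀ x) (u₀ x) v = 0) →
      (∀ x (j : Fin 3), ∫ v, F (x, v) * v j * localMaxwellian 1 (θ₀ x) (u₀ x) v = 0) →
      (∀ x, ∫ v, F (x, v) * ‖v‖ ^ 2 * localMaxwellian 1 (θ₀ x) (u₀ x) v = 0) →
      ∀ β : ℝ, |β| ≤ β₀ → ∀ ε : ℝ, 0 < ε → ∃ τ₀ : ℝ, 0 < τ₀ ∧ ∀ τ : ℝ, τ₀ ≤ τ →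
      ∃ N₀ : ℕ, ∀ N : ℕ, N₀ ≤ N →
        ∫⁻ z, ENNReal.ofReal (Real.exp (β * ∑ i : Fin (N + 1),
            (τ * ((N : ℝ) + 1) ^ (-(1 / 3 : ℝ)))⁻¹ *
              ∫ r in (0 : ℝ)..(τ * ((N : ℝ) + 1) ^ (-(1 / 3 : ℝ))), F (((Φ N).flow r z) i)))
          ∂(localGibbsLaw σ a u₀ θ₀ N (Φ N)) ≤
        ENNReal.ofReal (Real.exp (ε * ((N : ℝ) + 1)))

/-- registered stub signature (target of `stub_explicitKineticFamily`) of line tail-rate, crux TransferEntropyClock (stmt-AtomisticToContinuum-16625) — route-internal, not a cited fact.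
**S_E target `KineticLDExplicitFamily`** — the kinetic window LD ALONG FAMILIES with a threshold EXPLICIT IN THE GROWTH
CONSTANT: frame of the heart's `KineticCurrentsWindowLDFamily` (= crux 16659, same body), but `∃ β₁ > 0` is chosen after the
profile family `s ↦ (a_s, θ_s, u_s)`, `σ` and the flows and BEFORE the weights `(A, b, G)` and their quadratic-growth constant
`C`, and the bound is asserted for `|β| ≤ β₁ / C`. So along a truncation family `G_m` with constants `C₀ m` the threshold
degrades exactly like `1/m` — the law forced by large Galilean boosts (see the module docstring) and all this line needs.
Strictly between the consumable-but-unprovable-from-black-boxes `∃ β₀`-per-instance node and the refuted `∀ β` node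
(`TransferEntropyClockNegative.not_kineticWindowLDBoundedAllBeta`, p127781). Implies 16659 (take the family's own `C`). -/
def KineticLDExplicitFamily : Prop :=
  ∃ η₀ : ℝ, 0 < η₀ ∧ ∀ (t₁ : ℝ) (a θ₀ : ℝ → T3 → ℝ) (u₀ : ℝ → T3 → V3),
    Continuous (Function.uncurry a) → Continuous (Function.uncurry θ₀) → Continuous (Function.uncurry u₀) →
    (∀ s x, 0 < a s x) → (∀ s x, 0 < θ₀ s x) →
    ∀ σ : ℝ, 0 < σ → (∀ s ∈ Set.Icc 0 t₁, σ ^ 3 * (⨆ x, a s x) ≤ η₀ * ∫ x, a s x) →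
    ∀ Φ : (N : ℕ) → HardSphereFlow (Torus.geometry (Fin 3)) (hsDiameter σ N) (N + 1),
    ∃ β₁ : ℝ, 0 < β₁ ∧
    ∀ (A : ℝ → T3 → Fin 3 → Fin 3 → ℝ) (b : ℝ → T3 → V3) (G : ℝ → T3 × ℝ → ℝ),
    Continuous (Function.uncurry A) → Continuous (Function.uncurry b) → Continuous (Function.uncurry G) →
    ∀ C : ℝ, 0 < C →
    (let F := fun (s : ℝ) (y : T3 × V3) =>
       (∑ j : Fin 3, ∑ k : Fin 3, A s y.1 j k * ((y.2 - u₀ s y.1) j * (y.2 - u₀ s y.1) k)) +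
         (∑ j : Fin 3, b s y.1 j * (y.2 - u₀ s y.1) j) * G s (y.1, ‖y.2 - u₀ s y.1‖ ^ 2)
     (∀ s ∈ Set.Icc 0 t₁, ∀ y : T3 × V3, |F s y| ≤ C * (1 + ‖y.2‖ ^ 2)) →
     (∀ s ∈ Set.Icc 0 t₁, ∀ x, ∫ v, F s (x, v) * localMaxwellian 1 (θ₀ s x) (u₀ s x) v = 0) →
     (∀ s ∈ Set.Icc 0 t₁, ∀ x (j : Fin 3),
        ∫ v, F s (x, v) * v j * localMaxwellian 1 (θ₀ s x) (u₀ s x) v = 0) →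
     (∀ s ∈ Set.Icc 0 t₁, ∀ x, ∫ v, F s (x, v) * ‖v‖ ^ 2 * localMaxwellian 1 (θ₀ s x) (u₀ s x) v = 0) →
     ∀ β : ℝ, |β| ≤ β₁ / C → ∀ ε : ℝ, 0 < ε → ∃ τ₀ : ℝ, 0 < τ₀ ∧ ∀ τ : ℝ, τ₀ ≤ τ →
     ∃ N₀ : ℕ, ∀ N : ℕ, N₀ ≤ N → ∀ s ∈ Set.Icc 0 t₁,
       ∫⁻ z, ENNReal.ofReal (Real.exp (β * ∑ i : Fin (N + 1),
           (τ * ((N : ℝ) + 1) ^ (-(1 / 3 : ℝ)))⁻¹ *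
             ∫ r in (0 : ℝ)..(τ * ((N : ℝ) + 1) ^ (-(1 / 3 : ℝ))), F s ((Φ N).flow r z i)))
         ∂(localGibbsLaw σ (a s) (u₀ s) (θ₀ s) N (Φ N)) ≤
       ENNReal.ofReal (Real.exp (ε * ((N : ℝ) + 1))))

/-- registered stub signature `stub_tailRateWindowClause` of line tail-rate, crux TransferEntropyClock (stmt-AtomisticToContinuum-16625) — route-internal, not a cited fact.
S_W′ (lead's reshape of the strategist's S_W `TailRateCore`): **the D-shape one-window entropy ledger of the shared heart from the
tail-rate inputs** — the explicit kinetic family node, the local transfer family node, the two activity tails, the N-uniform Gaussian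
velocity moments along the true evolution (item stmt-14415 `UGibbsSRBRigidity.GaussianTails`) and ECT. The conclusion (from
`∀ (r : ℝ) (Rf : ℝ → ℝ), 0 < r →` on: EOS insertion factor, uniform local Gibbs concentration input, then `∃ ηp …` static clause and
D-ledger `∀ δ ∃ K ∃ ε, 4(1+t) ε e^{2Kt} ≤ δ ∧ ∃ τ ∃ N₀ ∀ N ∀ s, H(s+w) ≤ H(s) + K w sup H + w(N+1)ε + statics`) is VERBATIM the conclusion of
17615's landed `ClampedTransferDockRate.WindowClauseRate` (p139114) = the hypothesis of the landed `ClampedTransferDockLedgerEndD.LedgerEndD`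
(p139514). Proof route (the strategist's S_W recipe, re-cut at the TAIL level): per window `ClampedTransferDockRate.stub_windowEstimateRate`
(p136014) with the kinetic cut-off `G := G_{K₁}` (continuous re-orthogonalised cut-off of `s′ − 5θ` at level `K₁`, growth `C₀(K₁+1)`),
kinetic input `hKs` from `KineticLDExplicitFamily` at tilt `β(K₁) = β₁/(C₀(K₁+1))` (the one place the explicit node is needed), collisional
inputs from the local transfer node, `hTs` from CAT/CEAT, third moments from ECT, and the cubic channel `hQs` paid by the TAIL ALONE (remainder
supported on `‖W‖ > K₁`; Gaussian moments ⇒ cubic tails `≤ e^{-cK₁}` at any rate `c`, shifted by `U = sup‖u‖` as in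
`ClampedTransferDockSeet.seet_shifted`, Tonelli `ClampedCurrentsDockCubicChannelPrelim.cubicTailWindow`) — NO band, NO coherence term; rate
`K(K₁) = 5/β(K₁) ≍ K₁` against the floor `A e^{-cK₁}` with `c := 2·(5C₀/β₁)·t + 1` (`ClampedTransferDockRate.rate_budget`-type arithmetic),
then `ledger_step`. Template: `ClampedTransferDockRate.stub_windowClauseRate` (399 lines). L, provable-now grade. -/
def TailRateWindowClause : Prop :=
  KineticLDExplicitFamily → LocalClampedTransferWindowLDFamily → CollisionEnergyActivityTails →
    OneFlightGossipEngine.CollisionActivityTails → UGibbsSRBRigidity.GaussianTails → OneFlightGossipEngine.EnergyCurrentTails →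
  ∀ (r : ℝ) (Rf : ℝ → ℝ), 0 < r →
    (∃ p : FormalMultilinearSeries ℝ ℝ ℝ, HasFPowerSeriesOnBall Rf p 0 (ENNReal.ofReal r)) →
    (∃ L : NNReal, LipschitzOnWith L Rf (Icc 0 r)) →
    (∀ x ∈ Ioo (-r) r, 0 < Rf x ∧ Rf x * (∑' j : ℕ, bE j / (j.factorial : ℝ) * (x * Rf x) ^ j) = 1) →
    (∀ x ∈ Icc 0 r, 1 ≤ Rf x ∧ Rf x ≤ 2) → ContinuousOn Rf (Icc 0 r) →
    (∀ x ∈ Ioo (-r) r, ∀ R ∈ Icc (1 / 2 : ℝ) 2,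
      R * (∑' j : ℕ, bE j / (j.factorial : ℝ) * (x * R) ^ j) = 1 → R = Rf x) →
    ∀ η₀ : ℝ, 0 < η₀ →
    (∀ (a θ₀ : T3 → ℝ) (u₀ : T3 → V3), Continuous a → Continuous θ₀ → Continuous u₀ → (∀ x, 0 < a x) →
      (∀ x, 0 < θ₀ x) → ∀ σ : ℝ, 0 < σ → σ ^ 3 * (⨆ x, a x) ≤ η₀ * ∫ x, a x →
      ∃ ρ₀ : T3 → ℝ, Continuous ρ₀ ∧ (∀ x, 0 < ρ₀ x) ∧
        (∀ (N : ℕ) (Φ : HardSphereFlow (Torus.geometry (Fin 3)) (hsDiameter σ N) (N + 1)),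
          IsProbabilityMeasure (localGibbsLaw σ a u₀ θ₀ N Φ)) ∧
        ∀ χ : T3 → ℝ, Continuous χ → ∀ δ : ℝ, 0 < δ → ∃ C : ℝ, 0 < C ∧
          ∀ (N : ℕ) (Φ : HardSphereFlow (Torus.geometry (Fin 3)) (hsDiameter σ N) (N + 1)),
            localGibbsLaw σ a u₀ θ₀ N Φ {z | δ < |empiricalDensityField z χ - ∫ x, χ x * ρ₀ x|} ≤
                ENNReal.ofReal (C * Real.exp (-(C⁻¹ * ((N : ℝ) + 1)))) ∧
              localGibbsLaw σ a u₀ θ₀ N Φ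
                  {z | δ < ‖empiricalMomentumField z χ - ∫ x, (χ x * ρ₀ x) • u₀ x‖} ≤
                ENNReal.ofReal (C * Real.exp (-(C⁻¹ * ((N : ℝ) + 1)))) ∧
              localGibbsLaw σ a u₀ θ₀ N Φ {z | δ < |empiricalEnergyField z χ -
                  ∫ x, χ x * totalEnergyDensity (ρ₀ x) (u₀ x) (θ₀ x)|} ≤
                ENNReal.ofReal (C * Real.exp (-(C⁻¹ * ((N : ℝ) + 1))))) →
    ∃ ηp : ℝ, 0 < ηp ∧
    ∀ (a₀ θ₀ : T3 → ℝ) (u₀ : T3 → V3), Continuous a₀ → Continuous θ₀ → Continuous u₀ →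
      (∀ x, 0 < a₀ x) → (∀ x, 0 < θ₀ x) →
      ∃ σ₀ : ℝ, 0 < σ₀ ∧ ∀ σ : ℝ, 0 < σ → σ < σ₀ →
        ∀ (T : ℝ) (ρ θ : ℝ → T3 → ℝ) (u : ℝ → T3 → V3), IsHardSphereEulerSolution σ T ρ u θ →
          (∀ s ∈ Set.Ico 0 T, ∀ x, ρ s x * σ ^ 3 < ηp) →
          ∀ Φ : (N : ℕ) → HardSphereFlow (Torus.geometry (Fin 3)) (hsDiameter σ N) (N + 1),
            TendstoHydroFieldsAt (fun N => localGibbsLaw σ a₀ u₀ θ₀ N (Φ N)) Φ ρ u θ 0 →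
            ∀ t ∈ Set.Ioo 0 T,
              ∃ Cst : ℝ → ℝ, ContinuousOn Cst (Set.Icc 0 t) ∧
                (∀ ε : ℝ, 0 < ε → ∃ N₀ : ℕ, ∀ N : ℕ, N₀ ≤ N → ∀ t' ∈ Set.Icc 0 t,
                  |Real.log (posPartition (fun x => ρ t' x * Rf (σ ^ 3 * ρ t' x)) (hsDiameter σ N) (N + 1)) -
                      Real.log (posPartition (fun x => ρ 0 x * Rf (σ ^ 3 * ρ 0 x)) (hsDiameter σ N) (N + 1)) +
                    ((N : ℝ) + 1) * ∫ r in (0 : ℝ)..t', Cst r| ≤ ((N : ℝ) + 1) * ε) ∧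
                ∀ δ : ℝ, 0 < δ → ∃ K : ℝ, 0 ≤ K ∧ ∃ ε : ℝ, 0 < ε ∧ 4 * (1 + t) * ε * Real.exp (2 * K * t) ≤ δ ∧
                ∃ τ : ℝ, 0 < τ ∧ ∃ N₀ : ℕ, ∀ N : ℕ, N₀ ≤ N →
                ∀ s : ℝ, 0 ≤ s → s + τ * ((N : ℝ) + 1) ^ (-(1 / 3 : ℝ)) ≤ t →
                (klDiv ((Φ N).lawAt (localGibbsLaw σ a₀ u₀ θ₀ N (Φ N)) (s + τ * ((N : ℝ) + 1) ^ (-(1 / 3 : ℝ))))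
                  (localGibbsLaw σ (fun x => ρ (s + τ * ((N : ℝ) + 1) ^ (-(1 / 3 : ℝ))) x *
                      Rf (σ ^ 3 * ρ (s + τ * ((N : ℝ) + 1) ^ (-(1 / 3 : ℝ))) x))
                    (u (s + τ * ((N : ℝ) + 1) ^ (-(1 / 3 : ℝ)))) (θ (s + τ * ((N : ℝ) + 1) ^ (-(1 / 3 : ℝ))))
                    N (Φ N))).toReal ≤
                (klDiv ((Φ N).lawAt (localGibbsLaw σ a₀ u₀ θ₀ N (Φ N)) s)
                  (localGibbsLaw σ (fun x => ρ s x * Rf (σ ^ 3 * ρ s x)) (u s) (θ s) N (Φ N))).toReal +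
                K * (τ * ((N : ℝ) + 1) ^ (-(1 / 3 : ℝ))) *
                  sSup ((fun s' => (klDiv ((Φ N).lawAt (localGibbsLaw σ a₀ u₀ θ₀ N (Φ N)) s')
                    (localGibbsLaw σ (fun x => ρ s' x * Rf (σ ^ 3 * ρ s' x)) (u s') (θ s') N (Φ N))).toReal) ''
                    Set.Icc 0 (s + τ * ((N : ℝ) + 1) ^ (-(1 / 3 : ℝ)))) +
                (τ * ((N : ℝ) + 1) ^ (-(1 / 3 : ℝ))) * ((N : ℝ) + 1) * ε +
                ((Real.log (posPartition (fun x => ρ (s + τ * ((N : ℝ) + 1) ^ (-(1 / 3 : ℝ))) x *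
                      Rf (σ ^ 3 * ρ (s + τ * ((N : ℝ) + 1) ^ (-(1 / 3 : ℝ))) x)) (hsDiameter σ N) (N + 1)) -
                    Real.log (posPartition (fun x => ρ s x * Rf (σ ^ 3 * ρ s x)) (hsDiameter σ N) (N + 1))) +
                  (τ * ((N : ℝ) + 1) ^ (-(1 / 3 : ℝ))) * ((N : ℝ) + 1) * Cst s)

/-! ## §2 Kernel-checked remarks -/

/-- **The explicit family node implies the heart's (= crux 16659's) family node**: instantiate `C` with the family's own growth constant
(made positive). [folklore] -/
theorem kineticCurrentsWindowLDFamily_of_explicit (h : KineticLDExplicitFamily) : KineticCurrentsWindowLDFamily := by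
  obtain ⟨η₀, hη₀, H⟩ := h
  refine ⟨η₀, hη₀, fun t₁ a θ₀ u₀ ha hθ hu ha0 hθ0 σ hσ hg Φ A b G hA hb hG => ?_⟩
  obtain ⟨β₁, hβ₁, H1⟩ := H t₁ a θ₀ u₀ ha hθ hu ha0 hθ0 σ hσ hg Φ
  intro F hC ho1 ho2 ho3
  obtain ⟨C, hC⟩ := hC
  have hCpos : 0 < max C 1 := lt_max_of_lt_right one_pos
  have hC' : ∀ s ∈ Set.Icc 0 t₁, ∀ y : T3 × V3, |F s y| ≤ max C 1 * (1 + ‖y.2‖ ^ 2) := fun s hs y =>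
    (hC s hs y).trans (mul_le_mul_of_nonneg_right (le_max_left _ _) (by positivity))
  exact ⟨β₁ / max C 1, div_pos hβ₁ hCpos, fun β hβ ε hε =>
    H1 A b G hA hb hG (max C 1) hCpos hC' ho1 ho2 ho3 β hβ ε hε⟩

/-- **The explicit family node implies crux 16659 `KineticCurrentsLDAlongFamilies`** (same term as the heart's family node). [folklore] -/
theorem kineticCurrentsLDAlongFamilies_of_explicit (h : KineticLDExplicitFamily) :
    OneFlightGossipEngine.KineticCurrentsLDAlongFamilies :=
  show KineticCurrentsWindowLDFamily from kineticCurrentsWindowLDFamily_of_explicit h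

/-- **S_K subsumes crux 16659**: `KCWUSharpPlus` implies `KineticCurrentsLDAlongFamilies` (the landed certificate p137412). [folklore] -/
theorem kineticCurrentsLDAlongFamilies_of_kcwuSharpPlus (h : KCWUSharpPlus) :
    OneFlightGossipEngine.KineticCurrentsLDAlongFamilies :=
  KineticCurrentsLDAlongFamiliesSketch.stub_kcwuSharpPlus_implies_crux h

/-! ## §3 The conditional closing of the line -/

/-- **The guarded Grönwall core from the D-ledger and the true-law tails**: S_W′ fed its six inputs, then the landed window continuity (CAT,
CEAT, ECT), the landed a-priori bound and the landed D-ledger end `stub_ledgerEndD` — 17615's closing p140743 with its window clause replaced by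
the tail-rate D-ledger. [cite: Yau1991, §2] -/
theorem gronwallCoreInBand_of_tailRateLedger (hW : TailRateWindowClause) (hKE : KineticLDExplicitFamily)
    (hL : LocalClampedTransferWindowLDFamily) (hG : UGibbsSRBRigidity.GaussianTails) (h₇ : TwoClocks.TransferActivityTails)
    (h₆ : TwoClocks.EnergyCurrentTails) : GronwallCoreInBand :=
  have hT := HydroLimitInBandHeart.activityTails_of_transferActivityTails
    (TransferEntropyClockFamilyNodes.transferActivityTails_iff_dock.mp h₇)
  have h₆' : OneFlightGossipEngine.EnergyCurrentTails := twoClocks_energyCurrentTails_iff.mp h₆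
  have hC : ClampedCurrentsDockFromWindows.WindowContinuityInBand :=
    HydroLimitInBandContinuity.stub_windowContinuityInBand hT.1 hT.2 h₆'
  ClampedTransferDockLedgerEndD.stub_ledgerEndD (hW hKE hL hT.2 hT.1 hG h₆') hC EntropyClockDock.ledgerAprioriBound

/-- **The conditional closing of line tail-rate**: the crux BY NAME from the five stubs as hypotheses — S_E (explicit-family upgrade), S_W′
(D-ledger), S_K (the rung), S_L's target (the local transfer family node) and S_G (item 14415). `ClampedTransferWindowLD` is idle (the local
transfer node is taken directly; C′ is its constant-family instance), `TransferActivityTails` and `EnergyCurrentTails` are consumed,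
`KineticWindowLDUniform` and `DiluteSelfConsistency` are idle. [cite: Yau1991, §2] -/
theorem transferEntropyClock_of_tailRateNodes :
    (KCWUSharpPlus → KineticLDExplicitFamily) → TailRateWindowClause → KCWUSharpPlus → LocalClampedTransferWindowLDFamily →
      UGibbsSRBRigidity.GaussianTails → TwoClocks.TransferEntropyClock :=
  fun hE hW hK hL hG _ _ h₇ h₆ _ =>
    TransferEntropyClockFamilyNodes.hydrodynamicLimit_iff_hydroLimitInBand.mpr
      (Theorems.hydroLimitInBand_of_relEntropyVanishingInBand
        (Theorems.EntropyClockDock.relEntropyVanishingInBand_of_gronwallCoreInBand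
          (gronwallCoreInBand_of_tailRateLedger hW (hE hK) hL hG h₇ h₆)))

/-- **The 3-child split glue, conditional on the two provable stubs**: once S_E and S_W′ are theorems, `transferEntropyClock_of_tailRateChildren_of hE hW :
KCWUSharpPlus → LocalClampedTransferWindowLDFamily → UGibbsSRBRigidity.GaussianTails → TwoClocks.TransferEntropyClock` is the `--glue-by` theorem of the
split of 16625 into {KCWUSharpPlus, the local transfer node (= 17691), GaussianTails (= 14415)}. [cite: Yau1991, §2] -/
theorem transferEntropyClock_of_tailRateChildren_of (hE : KCWUSharpPlus → KineticLDExplicitFamily) (hW : TailRateWindowClause) :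
    KCWUSharpPlus → LocalClampedTransferWindowLDFamily → UGibbsSRBRigidity.GaussianTails → TwoClocks.TransferEntropyClock :=
  fun hK hL hG => transferEntropyClock_of_tailRateNodes hE hW hK hL hG

end Summit.AtomisticToContinuum.HydrodynamicLimit.Theorems.TransferEntropyClockTailRate

end
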